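import Summits.AtomisticToContinuum.HydrodynamicLimit.Theorems.AntiMazurCoboundariesCellForecastPressureDecayClusterTailInsertion
import Summits.AtomisticToContinuum.HydrodynamicLimit.Theorems.AntiMazurCoboundariesCellForecastPressureDecayClusterTailCharging
import Summits.AtomisticToContinuum.HydrodynamicLimit.Theorems.AntiMazurCoboundariesCellForecastPressureDecayClusterTailRemoval
import Summits.AtomisticToContinuum.HydrodynamicLimit.Theorems.AntiMazurCoboundariesCellForecastPressureDecayKinematicAssemblyClusterEnergy
import HarnessLib

/-!
# S2e(D) · the short-time cluster tail, piece 4: charging the first contact of a tagged sphere, pathwise and in the mean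
# (sub-goals `stub_clusterTail_firstOrder_firstHit`, `stub_clusterTail_firstOrder_chargingBound` of the registered
# sub-goal `stub_clusterTail_firstOrder` of stub `stub_clusterTail`, crux line `enskog-compensator-martingale`,
# crux `CellForecastPressureDecay`, stmt-AtomisticToContinuum-13915)

The particle-removal charging shared by the first-order estimate (`stub_clusterTail_firstOrder`) and the non-fresh
first-contact estimate (`stub_clusterTail_nonFresh`) of the short-time cluster tail `ClusterTail σ` (S2e), a
Lanford-type short-time estimate at fixed diameter WITHOUT a cluster expansion:

* PATHWISE (`eventually_exists_grid_charge`, on the good sets of the whole-cell flows): if the tagged sphere `i` of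
  the `(m+1)`-system takes part in no collision before `τ` and collides at `τ ∈ (0, Δ]` with `i.succAbove j`, then
  before `τ` it flies freely while the others follow the `m`-sphere flow of their own data (`stub_clusterTail_removal`),
  its partner flies freely since its own last collision before `τ`, so for every fine enough mesh `Δ/M` there is a
  grid time `a = kΔ/M < τ ≤ a + Δ/M` in between (`eventually_exists_grid`) at which the freely flown datum of `i`,
  RELATIVE TO THE BATH STATE of `j` at time `a`, lies in Boltzmann's collision cylinder of length `Δ/M`
  (`cylRel_of_affine_contact`);
* IN THE MEAN (`lintegral_chargingTerm_le`): for a measurable relation `R ⊆ ℝ³ × ℝ³` all of whose translated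
  sections `{y : (y − c, u) ∈ R}` have volume `≤ σ² h ‖u‖ S`, a measurable weight `Wt` of the tagged velocity and
  measurable bath weights `Wb(z', j)`, the charging functional `z ↦ Wt(vᵢ) ∑ⱼ Wb(z∖i, j) 1_R(xᵢ + a vᵢ − Xⱼ(a), vᵢ − Vⱼ(a))`
  (`(Xⱼ(a), Vⱼ(a))` the state at time `a` of the bath sphere `j` under the `m`-sphere flow of `z∖i`) has
  `P_{m+1,L}`-expectation `≤ 2 L⁻³ σ² h S ∫dγ(w) Wt(w) E_{P_{m,L}} ∑ⱼ Wb(·, j) ‖w − Vⱼ(a)‖` (insertion inequality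
  `lintegral_cellLaw_succ_le`, then Tonelli over the inserted position, which sees a translate of a section of `R`);
  and the mean bath speed `E_{P_{m,L}} ∑ⱼ ‖w − Vⱼ(t)‖ ≤ m (‖w‖ + 4)` (energy conservation + Maxwellian moments).

References: Cercignani–Illner–Pulvirenti 1994, §2.2 and App. 4.A; Gallagher–Saint-Raymond–Texier 2013, §4.1;
Lanford 1975, §3.
-/

noncomputable section

open MeasureTheory ProbabilityTheory Set Filter Topology
open scoped ENNReal BigOperators InnerProductSpace
open Literature.Analysis.FluidPDE Literature.MathematicalPhysics.KineticTheory
open Summit.AtomisticToContinuum.HydrodynamicLimit.Theorems.CellForecastPressureDecay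
  (cellCube measurableSet_cellCube volume_cellCube isProbabilityMeasure_cellLaw)

namespace Summit.AtomisticToContinuum.HydrodynamicLimit.Theorems.EnskogCompensator

variable {σ L : ℝ} {m : ℕ}

/-! ## Measurability of the charging functional -/

/-- Removing a label is measurable. [folklore] -/
theorem measurable_removeNth (i : Fin (m + 1)) :
    Measurable fun z : Cell (m + 1) => (fun c => z (i.succAbove c) : Cell m) :=
  measurable_pi_lambda _ fun _ => measurable_pi_apply _

/-- **The charging functional is measurable** in the datum (the time-`a` flow map is measurable, the
relation `R` is measurable). [folklore] -/
theorem measurable_chargingTerm (Ψ : Flows σ) (i : Fin (m + 1)) {R : Set (V3 × V3)} (hR : MeasurableSet R)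
    {Wt : V3 → ℝ≥0∞} (hWt : Measurable Wt) {Wb : Cell m → Fin m → ℝ≥0∞} (hWb : ∀ j, Measurable fun z' => Wb z' j)
    (a : ℝ) :
    Measurable fun z : Cell (m + 1) => Wt (z i).2 * ∑ j : Fin m, Wb (fun c => z (i.succAbove c)) j *
      R.indicator 1 ((z i).1 + a • (z i).2 - ((Ψ m).flow a (fun c => z (i.succAbove c)) j).1,
        (z i).2 - ((Ψ m).flow a (fun c => z (i.succAbove c)) j).2) := by
  have hrm := measurable_removeNth (m := m) i
  have hfl : Measurable fun z : Cell (m + 1) => (Ψ m).flow a (fun c => z (i.succAbove c)) :=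
    ((Ψ m).measurable_flow a).comp hrm
  have hzi : Measurable fun z : Cell (m + 1) => z i := measurable_pi_apply i
  refine (hWt.comp hzi.snd).mul (Finset.measurable_sum _ fun j _ => ((hWb j).comp hrm).mul ?_)
  have hj : Measurable fun z : Cell (m + 1) => (Ψ m).flow a (fun c => z (i.succAbove c)) j :=
    (measurable_pi_apply j).comp hfl
  exact (measurable_one.indicator hR).comp
    (((hzi.fst.add (hzi.snd.const_smul a)).sub hj.fst).prodMk (hzi.snd.sub hj.snd))

/-! ## The integrated charging bound -/

/-- The inserted position sees a translate of a section of `R`: under the uniform law on the cube,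
`∫ 1_R(y + a w − X, w − V) dν(y) ≤ L⁻³ σ² h ‖w − V‖ S`. [cite: CIP1994, §2.2] -/
theorem lintegral_cond_cellCube_indicator_le {L : ℝ} (hL : 0 < L) {R : Set (V3 × V3)} {h : ℝ} {S : ℝ≥0∞}
    (hvol : ∀ u c : V3, ∫⁻ y, R.indicator 1 (y - c, u) ≤ ENNReal.ofReal (σ ^ 2 * h * ‖u‖) * S)
    (a : ℝ) (w X V : V3) :
    ∫⁻ y, R.indicator (1 : V3 × V3 → ℝ≥0∞) (y + a • w - X, w - V) ∂(volume[|cellCube L]) ≤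
      ENNReal.ofReal ((L ^ 3)⁻¹) * (ENNReal.ofReal (σ ^ 2 * h * ‖w - V‖) * S) := by
  refine (lintegral_cond_cellCube_le_pow hL _).trans (mul_le_mul' le_rfl ?_)
  have heq : ∀ y : V3, y + a • w - X = y - (X - a • w) := fun y => by abel
  simp only [heq]
  exact hvol _ _

/-- **The integrated charging bound.** For `0 < σ ≤ 3/16`, `L ≥ 1`, `m + 1 ≤ 2L³`, a label `i`, a time `a`, a
measurable relation `R` whose translated sections have volume `≤ σ² h ‖u‖ S` (`S < ∞`, `h ≥ 0`), a measurable
weight `Wt` of the tagged velocity and measurable bath weights `Wb`: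
`E_{P_{m+1,L}} [Wt(vᵢ) ∑ⱼ Wb(z∖i, j) 1_R(xᵢ + a vᵢ − Xⱼ(a), vᵢ − Vⱼ(a))] ≤
2 L⁻³ σ² h S ∫dγ(w) Wt(w) E_{P_{m,L}} ∑ⱼ Wb(·, j) ‖w − Vⱼ(a)‖`, the bath evolved by the `m`-sphere flow
(insertion inequality, then Tonelli over the inserted position). [cite: CIP1994, App. 4.A] -/
theorem lintegral_chargingTerm_le (hσ : 0 < σ) (hσ' : σ ≤ 3 / 16) (hfac : CellLawFactorises σ) (hL : 1 ≤ L)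
    (hm : ((m + 1 : ℕ) : ℝ) ≤ 2 * L ^ 3) (Ψ : Flows σ) (i : Fin (m + 1)) {R : Set (V3 × V3)}
    (hR : MeasurableSet R) {h : ℝ} (hh : 0 ≤ h) {S : ℝ≥0∞} (hS : S ≠ ∞)
    (hvol : ∀ u c : V3, ∫⁻ y, R.indicator 1 (y - c, u) ≤ ENNReal.ofReal (σ ^ 2 * h * ‖u‖) * S)
    {Wt : V3 → ℝ≥0∞} (hWt : Measurable Wt) {Wb : Cell m → Fin m → ℝ≥0∞} (hWb : ∀ j, Measurable fun z' => Wb z' j)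
    (a : ℝ) :
    ∫⁻ z, Wt (z i).2 * ∑ j : Fin m, Wb (fun c => z (i.succAbove c)) j *
        R.indicator 1 ((z i).1 + a • (z i).2 - ((Ψ m).flow a (fun c => z (i.succAbove c)) j).1,
          (z i).2 - ((Ψ m).flow a (fun c => z (i.succAbove c)) j).2) ∂cellLaw σ L (m + 1) Ψ ≤
      2 * (ENNReal.ofReal ((L ^ 3)⁻¹) * ENNReal.ofReal (σ ^ 2 * h) * S) *
        ∫⁻ w, Wt w * ∫⁻ z', ∑ j : Fin m, Wb z' j * ENNReal.ofReal ‖w - ((Ψ m).flow a z' j).2‖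
          ∂cellLaw σ L m Ψ ∂stdGaussian V3 := by
  have hL0 : 0 < L := one_pos.trans_le hL
  set ν : Measure V3 := volume[|cellCube L] with hν
  set c : ℝ≥0∞ := ENNReal.ofReal ((L ^ 3)⁻¹) with hc
  set K : ℝ≥0∞ := c * ENNReal.ofReal (σ ^ 2 * h) * S with hK
  have hKtop : K ≠ ∞ := ENNReal.mul_ne_top (ENNReal.mul_ne_top ENNReal.ofReal_ne_top ENNReal.ofReal_ne_top) hS
  refine (lintegral_cellLaw_succ_le hσ hσ' hfac hL hm Ψ i (measurable_chargingTerm Ψ i hR hWt hWb a)).trans ?_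
  simp only [Fin.insertNth_apply_same, removeNth_insertNth_cell]
  -- the inner integral over the inserted position
  have hy : ∀ (w : V3) (z' : Cell m),
      ∫⁻ y, Wt w * ∑ j : Fin m, Wb z' j * R.indicator 1 (y + a • w - ((Ψ m).flow a z' j).1,
        w - ((Ψ m).flow a z' j).2) ∂ν ≤
      Wt w * ∑ j : Fin m, Wb z' j * (c * (ENNReal.ofReal (σ ^ 2 * h * ‖w - ((Ψ m).flow a z' j).2‖) * S)) := by
    intro w z'
    have hmj : ∀ j : Fin m, Measurable fun y : V3 => R.indicator (1 : V3 × V3 → ℝ≥0∞)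
        (y + a • w - ((Ψ m).flow a z' j).1, w - ((Ψ m).flow a z' j).2) := fun j =>
      (measurable_one.indicator hR).comp ((measurable_id.add_const _ |>.sub_const _).prodMk measurable_const)
    rw [lintegral_const_mul _ (Finset.measurable_sum _ fun j _ => (hmj j).const_mul _),
      lintegral_finsetSum _ fun j _ => (hmj j).const_mul _]
    refine mul_le_mul' le_rfl (Finset.sum_le_sum fun j _ => ?_)
    rw [lintegral_const_mul _ (hmj j)]
    exact mul_le_mul' le_rfl (lintegral_cond_cellCube_indicator_le hL0 hvol a w _ _)
  -- integrate the bound in `z'` and `w`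
  have hmz : ∀ w : V3, Measurable fun z' : Cell m =>
      ∑ j : Fin m, Wb z' j * ENNReal.ofReal ‖w - ((Ψ m).flow a z' j).2‖ := fun w =>
    Finset.measurable_sum _ fun j _ => (hWb j).mul
      ((((measurable_pi_apply j).comp ((Ψ m).measurable_flow a)).snd.const_sub w).norm.ennreal_ofReal)
  calc 2 * ∫⁻ w, ∫⁻ z', ∫⁻ y, Wt w * ∑ j : Fin m, Wb z' j * R.indicator 1 (y + a • w - ((Ψ m).flow a z' j).1,
          w - ((Ψ m).flow a z' j).2) ∂ν ∂cellLaw σ L m Ψ ∂stdGaussian V3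
      ≤ 2 * ∫⁻ w, ∫⁻ z', Wt w * ∑ j : Fin m, Wb z' j *
          (c * (ENNReal.ofReal (σ ^ 2 * h * ‖w - ((Ψ m).flow a z' j).2‖) * S)) ∂cellLaw σ L m Ψ ∂stdGaussian V3 :=
        mul_le_mul' le_rfl (lintegral_mono fun w => lintegral_mono fun z' => hy w z')
    _ = 2 * ∫⁻ w, Wt w * (K * ∫⁻ z', ∑ j : Fin m, Wb z' j * ENNReal.ofReal ‖w - ((Ψ m).flow a z' j).2‖
          ∂cellLaw σ L m Ψ) ∂stdGaussian V3 := by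
        congr 1
        refine lintegral_congr fun w => ?_
        rw [← lintegral_const_mul' _ _ hKtop, ← lintegral_const_mul'' _ (((hmz w).const_mul K).aemeasurable)]
        refine lintegral_congr fun z' => ?_
        rw [Finset.mul_sum, Finset.mul_sum, Finset.mul_sum]
        refine Finset.sum_congr rfl fun j _ => ?_
        rw [ENNReal.ofReal_mul (by positivity : 0 ≤ σ ^ 2 * h), hK]
        ring
    _ = 2 * (c * ENNReal.ofReal (σ ^ 2 * h) * S) * ∫⁻ w, Wt w * ∫⁻ z', ∑ j : Fin m,
          Wb z' j * ENNReal.ofReal ‖w - ((Ψ m).flow a z' j).2‖ ∂cellLaw σ L m Ψ ∂stdGaussian V3 := by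
        rw [mul_assoc 2, ← lintegral_const_mul' _ _ hKtop]
        congr 1
        refine lintegral_congr fun w => ?_
        ring

/-! ## The mean speed of the bath -/

/-- **Speeds are controlled by the initial kinetic energy**: along the `m`-sphere flow of a good datum,
`∑ⱼ ‖Vⱼ(t)‖ ≤ m + ∑ⱼ ‖vⱼ‖²` for `t ≥ 0` (`‖V‖ ≤ 1 + ‖V‖²` and conservation of the total kinetic energy,
`stub_kinematicAssembly_clusterEnergy` with the whole group). [cite: GST2013, §1.1] -/
theorem sum_norm_vel_flow_le (Ψ : Flows σ) {z' : Cell m} (hz' : z' ∈ (Ψ m).good) {t : ℝ} (ht : 0 ≤ t) :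
    ∑ j, ‖((Ψ m).flow t z' j).2‖ ≤ m + ∑ j, ‖(z' j).2‖ ^ 2 := by
  have h := (stub_kinematicAssembly_clusterEnergy σ m Ψ z' hz' Finset.univ t
    (fun _ _ _ _ _ _ => by simp) t ⟨ht, le_rfl⟩).1
  calc ∑ j, ‖((Ψ m).flow t z' j).2‖ ≤ ∑ j : Fin m, (1 + ‖((Ψ m).flow t z' j).2‖ ^ 2) :=
        Finset.sum_le_sum fun j _ => by
          nlinarith [sq_nonneg (‖((Ψ m).flow t z' j).2‖ - 1), norm_nonneg ((Ψ m).flow t z' j).2]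
    _ = m + ∑ j, ‖(z' j).2‖ ^ 2 := by
        rw [Finset.sum_add_distrib, h]
        simp

/-- **The mean bath speed seen from a velocity `w`**: for `σ ≤ 3/16`, `L ≥ 1`, `m ≤ 2L³` and `t ≥ 0`,
`E_{P_{m,L}} ∑ⱼ ‖w − Vⱼ(t)‖ ≤ m (‖w‖ + 4)` (energy conservation and the Maxwellian second moment
`E ∑ⱼ ‖vⱼ‖² ≤ 3m`, `lintegral_kinetic_cellLaw_le`). [folklore] -/
theorem lintegral_sum_norm_sub_vel_le (hσ' : σ ≤ 3 / 16) (hfac : CellLawFactorises σ) (hL : 1 ≤ L)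
    (hm0 : (m : ℝ) ≤ 2 * L ^ 3) (Ψ : Flows σ) (w : V3) {t : ℝ} (ht : 0 ≤ t) :
    ∫⁻ z', ∑ j : Fin m, ENNReal.ofReal ‖w - ((Ψ m).flow t z' j).2‖ ∂cellLaw σ L m Ψ ≤
      ENNReal.ofReal (m * (‖w‖ + 4)) := by
  haveI : IsProbabilityMeasure (cellLaw σ L m Ψ) := isProbabilityMeasure_cellLaw hσ' hL hm0 (Ψ m)
  haveI := isProbabilityMeasure_posLaw (posZ_ne_zero hσ' hL hm0)
  have hkin := lintegral_kinetic_cellLaw_le hfac L m Ψ (le_of_eq (measure_univ (μ := posLaw σ L m)))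
  have hpt : ∀ z' ∈ (Ψ m).good, ∑ j : Fin m, ENNReal.ofReal ‖w - ((Ψ m).flow t z' j).2‖ ≤
      ENNReal.ofReal (m * (‖w‖ + 1)) + ∑ j, ENNReal.ofReal (‖(z' j).2‖ ^ 2) := by
    intro z' hz'
    rw [← ENNReal.ofReal_sum_of_nonneg (fun j _ => norm_nonneg _),
      ← ENNReal.ofReal_sum_of_nonneg (fun j _ => sq_nonneg _),
      ← ENNReal.ofReal_add (by positivity) (Finset.sum_nonneg fun j _ => sq_nonneg _)]
    refine ENNReal.ofReal_le_ofReal ?_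
    have h2 := sum_norm_vel_flow_le Ψ hz' ht
    calc ∑ j, ‖w - ((Ψ m).flow t z' j).2‖ ≤ ∑ j : Fin m, (‖w‖ + ‖((Ψ m).flow t z' j).2‖) :=
          Finset.sum_le_sum fun j _ => norm_sub_le _ _
      _ = m * ‖w‖ + ∑ j, ‖((Ψ m).flow t z' j).2‖ := by
          rw [Finset.sum_add_distrib]
          simp
      _ ≤ m * (‖w‖ + 1) + ∑ j, ‖(z' j).2‖ ^ 2 := by linarith
  calc ∫⁻ z', ∑ j : Fin m, ENNReal.ofReal ‖w - ((Ψ m).flow t z' j).2‖ ∂cellLaw σ L m Ψ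
      ≤ ∫⁻ z', (ENNReal.ofReal (m * (‖w‖ + 1)) + ∑ j, ENNReal.ofReal (‖(z' j).2‖ ^ 2)) ∂cellLaw σ L m Ψ :=
        lintegral_mono_ae ((ae_mem_good_cellLaw σ L m Ψ).mono hpt)
    _ = ENNReal.ofReal (m * (‖w‖ + 1)) + ∫⁻ z', ∑ j, ENNReal.ofReal (‖(z' j).2‖ ^ 2) ∂cellLaw σ L m Ψ := by
        rw [lintegral_add_left measurable_const, lintegral_const, measure_univ, mul_one]
    _ ≤ ENNReal.ofReal (m * (‖w‖ + 1)) + 3 * m := add_le_add le_rfl hkin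
    _ = ENNReal.ofReal (m * (‖w‖ + 4)) := by
        rw [show (3 : ℝ≥0∞) * m = ENNReal.ofReal (3 * m) by
          rw [ENNReal.ofReal_mul (by norm_num), ENNReal.ofReal_ofNat, ENNReal.ofReal_natCast],
          ← ENNReal.ofReal_add (by positivity) (by positivity)]
        congr 1
        ring

/-! ## The first contact of a tagged sphere is charged at a grid time (pathwise) -/

/-- **Charging the first contact at a grid time.** On the good sets: if the tagged sphere `i` of the
`(m+1)`-system takes part in no collision at the times of `(0, τ)` and collides at `τ ∈ (0, Δ]` with the sphere
`i.succAbove j`, then for every fine enough mesh `Δ/M` there is a grid index `k < M` such that the free flight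
of the initial datum of `i` to the grid time `a = kΔ/M`, relative to the state at time `a` of the bath sphere
`j` under the `m`-sphere flow of the data with `i` removed, lies in the collision cylinder of length `Δ/M`
(removal until `τ`, free flight of `i` and of its partner since the partner's last collision, transversal
hit: `cylRel_of_affine_contact`). [cite: CIP1994, App. 4.A] -/
theorem eventually_exists_grid_charge (hσ : 0 < σ) (Ψ : Flows σ) {z : Cell (m + 1)}
    (hz : z ∈ (Ψ (m + 1)).good) {i : Fin (m + 1)} (hz' : (fun c => z (i.succAbove c)) ∈ (Ψ m).good)
    {j : Fin m} {Δ τ : ℝ} (hτ : τ ∈ Set.Ioc 0 Δ)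
    (hcol : Collide (Euclidean.geometry (Fin 3)) σ ((Ψ (m + 1)).flow τ z) i (i.succAbove j))
    (hnp : ∀ s ∈ Set.Ioo 0 τ, ¬ Participates (Euclidean.geometry (Fin 3)) σ ((Ψ (m + 1)).flow s z) i) :
    ∀ᶠ M : ℕ in atTop, ∃ k < M,
      (((z i).1 + ((k : ℝ) * (Δ / M)) • (z i).2 -
          ((Ψ m).flow ((k : ℝ) * (Δ / M)) (fun c => z (i.succAbove c)) j).1,
        (z i).2 - ((Ψ m).flow ((k : ℝ) * (Δ / M)) (fun c => z (i.succAbove c)) j).2) : V3 × V3) ∈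
      {p : V3 × V3 | PairHits σ p.1 p.2 ∧ 0 < pairDisc σ p.1 p.2 ∧ pairHitTime σ p.1 p.2 ∈ Set.Ioc 0 (Δ / M)} := by
  set γ : ℝ → Cell (m + 1) := fun s => (Ψ (m + 1)).flow s z with hγdef
  have hγ : IsHardSphereTrajectory (Euclidean.geometry (Fin 3)) σ (m + 1) γ := (Ψ (m + 1)).isTrajectory z hz
  have hij : i ≠ i.succAbove j := hcol.ne
  have hc : γ τ ∈ contactSet (Euclidean.geometry (Fin 3)) (m + 1) σ i (i.succAbove j) :=
    mem_contactSet_of_collide hcol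
  -- removal of `i` until `τ`
  have hrem : ∀ s ∈ Set.Ico 0 τ, (fun c => γ s (i.succAbove c)) = (Ψ m).flow s (fun c => z (i.succAbove c)) :=
    (stub_clusterTail_removal σ m Ψ τ).1 z i hz hz' hnp
  -- free flight of `i` on `[0, τ)`
  have hfi : ∀ s ∈ Set.Ico 0 τ, γ s i = ((z i).1 + s • (z i).2, (z i).2) := by
    intro s hs
    have h := stub_kinematicAssembly_noCollision σ (m + 1) Ψ z hz i 0 s hs.1
      (fun t ht => hnp t ⟨ht.1, ht.2.trans_lt hs.2⟩)
    rw [(Ψ (m + 1)).flow_zero z hz, sub_zero] at h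
    exact Prod.ext h.1 h.2
  -- the partner flies freely since its last collision before `τ`
  set fs := flightStart (Euclidean.geometry (Fin 3)) σ γ 0 (i.succAbove j) τ with hfs
  have hfin := hγ.finite_collisionTimesOf_inter_Ioo (i.succAbove j) 0 τ
  have hfs0 : 0 ≤ fs := le_flightStart hfin
  have hfsτ : fs < τ := flightStart_lt hfin hτ.1
  have hjfree : ∀ u ∈ Set.Ioo fs τ, ¬ Participates (Euclidean.geometry (Fin 3)) σ (γ u) (i.succAbove j) :=
    fun u hu => hγ.not_participates_of_mem_Ioo_flightStart hu
  -- the grid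
  filter_upwards [eventually_exists_grid hτ.1 hτ.2 (sub_pos.2 hfsτ)] with M hM
  obtain ⟨k, hkM, hkτ, hτk, hgap⟩ := hM
  refine ⟨k, hkM, ?_⟩
  set a : ℝ := (k : ℝ) * (Δ / M) with ha
  have hfa : fs < a := by rwa [sub_sub_cancel] at hgap
  have ha0 : 0 ≤ a := hfs0.trans hfa.le
  have haτ' : τ ≤ a + Δ / M := by
    have : ((k : ℝ) + 1) * (Δ / M) = a + Δ / M := by rw [ha]; ring
    linarith
  -- affine motions of `i` and of its partner on `[a, τ)`
  have hp : ∀ s ∈ Set.Ico a τ, γ s i = ((z i).1 + a • (z i).2 + (s - a) • (z i).2, (z i).2) := by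
    intro s hs
    rw [hfi s ⟨ha0.trans hs.1, hs.2⟩, add_assoc, ← add_smul]
    congr 3
    ring
  have hq : ∀ s ∈ Set.Ico a τ, γ s (i.succAbove j) =
      ((γ a (i.succAbove j)).1 + (s - a) • (γ a (i.succAbove j)).2, (γ a (i.succAbove j)).2) := by
    intro s hs
    have h := stub_kinematicAssembly_noCollision σ (m + 1) Ψ z hz (i.succAbove j) a s hs.1
      (fun t ht => hjfree t ⟨hfa.trans ht.1, ht.2.trans_lt hs.2⟩)
    exact Prod.ext h.1 h.2
  have hcyl := cylRel_of_affine_contact hσ hγ hij hkτ haτ' hp hq hc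
  -- the bath state of the partner at time `a`
  have hja : γ a (i.succAbove j) = (Ψ m).flow a (fun c => z (i.succAbove c)) j :=
    congrFun (hrem a ⟨ha0, hkτ⟩) j
  rw [hja] at hcyl
  exact hcyl

/-! ## The registered sub-goals -/

/-- **Registered sub-goal `stub_clusterTail_firstOrder_firstHit`** (piece of `stub_clusterTail_firstOrder`, S2e-1,
line `enskog-compensator-martingale`): **the first contact of a tagged sphere is charged at a grid time to a
Boltzmann cylinder around a sphere of the bath evolved without it** (closed form of `eventually_exists_grid_charge`).
[cite: CIP1994, App. 4.A] -/
theorem stub_clusterTail_firstOrder_firstHit : ∀ (σ : ℝ) (m : ℕ) (Ψ : Flows σ) (z : Cell (m + 1))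
    (i : Fin (m + 1)) (j : Fin m) (Δ τ : ℝ), 0 < σ → z ∈ (Ψ (m + 1)).good → (fun c => z (i.succAbove c)) ∈ (Ψ m).good →
    τ ∈ Set.Ioc 0 Δ → Collide (Euclidean.geometry (Fin 3)) σ ((Ψ (m + 1)).flow τ z) i (i.succAbove j) →
    (∀ s ∈ Set.Ioo 0 τ, ¬ Participates (Euclidean.geometry (Fin 3)) σ ((Ψ (m + 1)).flow s z) i) →
      ∀ᶠ M : ℕ in Filter.atTop, ∃ k < M,
        (((z i).1 + ((k : ℝ) * (Δ / M)) • (z i).2 - ((Ψ m).flow ((k : ℝ) * (Δ / M)) (fun c => z (i.succAbove c)) j).1,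
          (z i).2 - ((Ψ m).flow ((k : ℝ) * (Δ / M)) (fun c => z (i.succAbove c)) j).2) : V3 × V3) ∈
        {p : V3 × V3 | PairHits σ p.1 p.2 ∧ 0 < pairDisc σ p.1 p.2 ∧ pairHitTime σ p.1 p.2 ∈ Set.Ioc 0 (Δ / M)} :=
  fun _ _ Ψ _ _ _ _ _ hσ hz hz' hτ hcol hnp => eventually_exists_grid_charge hσ Ψ hz hz' hτ hcol hnp

/-- **Registered sub-goal `stub_clusterTail_firstOrder_chargingBound`** (piece of `stub_clusterTail_firstOrder`,
S2e-1, line `enskog-compensator-martingale`): **the integrated charging bound** (closed form of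
`lintegral_chargingTerm_le`): the expectation under `P_{m+1,L}` of a charging functional of a tagged sphere
against the bath evolved without it is at most `2 L⁻³ σ² h S ∫dγ(w) Wt(w) E_{P_{m,L}} ∑ⱼ Wb(·, j) ‖w − Vⱼ(a)‖`.
[cite: CIP1994, App. 4.A] -/
theorem stub_clusterTail_firstOrder_chargingBound : ∀ (σ L : ℝ) (m : ℕ), 0 < σ → σ ≤ 3 / 16 →
    CellLawFactorises σ → 1 ≤ L → ((m + 1 : ℕ) : ℝ) ≤ 2 * L ^ 3 → ∀ (Ψ : Flows σ) (i : Fin (m + 1))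
    (R : Set (V3 × V3)) (h : ℝ) (S : ℝ≥0∞) (Wt : V3 → ℝ≥0∞) (Wb : Cell m → Fin m → ℝ≥0∞) (a : ℝ),
    MeasurableSet R → 0 ≤ h → S ≠ ⊤ →
    (∀ u c : V3, ∫⁻ y, R.indicator 1 (y - c, u) ≤ ENNReal.ofReal (σ ^ 2 * h * ‖u‖) * S) → Measurable Wt →
    (∀ j, Measurable fun z' => Wb z' j) →
      ∫⁻ z, Wt (z i).2 * ∑ j : Fin m, Wb (fun c => z (i.succAbove c)) j *
          R.indicator 1 ((z i).1 + a • (z i).2 - ((Ψ m).flow a (fun c => z (i.succAbove c)) j).1,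
            (z i).2 - ((Ψ m).flow a (fun c => z (i.succAbove c)) j).2) ∂(cellLaw σ L (m + 1) Ψ) ≤
        2 * (ENNReal.ofReal ((L ^ 3)⁻¹) * ENNReal.ofReal (σ ^ 2 * h) * S) *
          ∫⁻ w, Wt w * ∫⁻ z', ∑ j : Fin m, Wb z' j * ENNReal.ofReal ‖w - ((Ψ m).flow a z' j).2‖
            ∂(cellLaw σ L m Ψ) ∂(ProbabilityTheory.stdGaussian V3) :=
  fun _ _ _ hσ hσ' hfac hL hm Ψ i _ _ _ _ _ a hR hh hS hvol hWt hWb =>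
    lintegral_chargingTerm_le hσ hσ' hfac hL hm Ψ i hR hh hS hvol hWt hWb a

end Summit.AtomisticToContinuum.HydrodynamicLimit.Theorems.EnskogCompensator

end
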